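import Mathlib
import HarnessLib
import Literature.NumberTheory.Sieve.BatemanHornProofs
import Literature.NumberTheory.Sieve.BatemanHornSelbergUpperBound
import Literature.NumberTheory.Sieve.PolynomialPrimesLinearSieveBound

/-!
# Route `OneSidedDegreeLadder`, crux `UpperQuadThree` (node «UpperLevelLadder», lens-1 g6): the BC5/T3 WITNESS —
# the PROVED rungs of the upper grade ladder

`UpperQuadThree` says: for every irreducible quadratic `q` with `IsBatemanHornSystem ![q]` and every `ε > 0`,
eventually `P_q(x) ≤ (3 + ε) · C(q)/2 · x/log x` (grade 3 ⇔ linear-sieve level x^{4/3}; open, beyond every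
printed level x^{1+γ_q}).  This file proves, from the tree alone (no new facts):
* `upperQuad_rung_four` — the SAME statement with the literal 3 replaced by 4 (grade 4 ⇔ the trivial level
  x^{1−o(1)}): tree `polyPrimeCount_single_le_linearSieve` (Greaves §2.3.3 Thm 4, k = 1), rescaled to
  Bateman–Horn units.  A proved TRUNCATION of the crux in a regime where the summit is open (Bateman–Horn is
  open on every quadratic cell) — the tribunal's T3 witness of weakness; rung credit in level currency only.
* `upperGrade_single_rung` — grade `2·deg q` for every single Bateman–Horn polynomial (same source).
* `upperGrade_selberg_rung` — grade `2^k·k!·∏ deg fᵢ` for every Bateman–Horn system (tree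
  `BatemanHornSelberg.polyPrimeCount_le_selbergSieve`, Selberg's sieve / Bateman–Horn (1962) (3)).
Candidate file by the planner (lens-1 g6), landed route-INDEPENDENT (Literature imports only; the hand dropped the
unused `Theses.OneSidedDegreeLadder` import) as
`Summits/Parity/BatemanHorn/Theorems/OneSidedDegreeLadderUpperGradeRungs.lean --supports <UpperQuadThree item>`.
-/

open Filter Finset Polynomial

open Literature.NumberTheory.Sieve

namespace Summit.Parity.BatemanHorn.Theorems.UpperGradeRungs

/-- **Rung θ = 4 on the quadratic cell** (`UpperQuadThree` with 3 ↦ 4): for every Bateman–Horn quadratic `q`,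
eventually `P_q(x) ≤ (4 + ε) · C(q)/2 · x/log x`. [tree: polyPrimeCount_single_le_linearSieve] -/
theorem upperQuad_rung_four :
    ∀ q : Polynomial ℤ, Literature.NumberTheory.Sieve.IsBatemanHornSystem ![q] → q.natDegree = 2 →
      ∀ ε : ℝ, 0 < ε → ∀ᶠ x : ℕ in Filter.atTop,
        (Literature.NumberTheory.Sieve.polyPrimeCount ![q] x : ℝ) ≤
          (4 + ε) * (Literature.NumberTheory.Sieve.batemanHornConst ![q] / 2 * (x : ℝ) / Real.log x) := by
  intro q hq _ ε hε
  have hC := (IsBatemanHornSystem.hasBatemanHornConst_holds hq).1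
  filter_upwards [polyPrimeCount_single_le_linearSieve hq hC (ε := ε / 2) (by positivity)] with x hx
  refine hx.trans (le_of_eq ?_)
  ring

/-- **Rung θ = 2·deg for a single polynomial**, in Bateman–Horn units `C(q)/deg q · x/log x`.
[tree: polyPrimeCount_single_le_linearSieve] -/
theorem upperGrade_single_rung {q : Polynomial ℤ} (hq : IsBatemanHornSystem ![q]) {ε : ℝ} (hε : 0 < ε) :
    ∀ᶠ x : ℕ in Filter.atTop, (polyPrimeCount ![q] x : ℝ) ≤
      (2 * (q.natDegree : ℝ) + ε) * (batemanHornConst ![q] / (q.natDegree : ℝ) * (x : ℝ) / Real.log x) := by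
  have hC := (IsBatemanHornSystem.hasBatemanHornConst_holds hq).1
  have hg : (0 : ℝ) < (q.natDegree : ℝ) := by exact_mod_cast hq.natDegree_pos 0
  filter_upwards [polyPrimeCount_single_le_linearSieve hq hC (ε := ε / q.natDegree) (by positivity)]
    with x hx
  refine hx.trans (le_of_eq ?_)
  field_simp

/-- **Selberg's rung θ = 2^k·k!·∏ deg fᵢ for every Bateman–Horn system**, in Bateman–Horn units.
[tree: BatemanHornSelberg.polyPrimeCount_le_selbergSieve] -/
theorem upperGrade_selberg_rung {k : ℕ} {f : Fin k → Polynomial ℤ} (hf : IsBatemanHornSystem f) {ε : ℝ}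
    (hε : 0 < ε) :
    ∀ᶠ x : ℕ in Filter.atTop, (polyPrimeCount f x : ℝ) ≤
      (2 ^ k * (k.factorial : ℝ) * (∏ i, ((f i).natDegree : ℝ)) + ε) *
        (batemanHornConst f / (∏ i, ((f i).natDegree : ℝ)) * (x : ℝ) / Real.log x ^ k) := by
  have hD : 0 < ∏ i, ((f i).natDegree : ℝ) :=
    Finset.prod_pos fun i _ => by exact_mod_cast hf.natDegree_pos i
  have hDne : (∏ i, ((f i).natDegree : ℝ)) ≠ 0 := hD.ne'
  filter_upwards [BatemanHornSelberg.polyPrimeCount_le_selbergSieve hf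
    (ε := ε / ∏ i, ((f i).natDegree : ℝ)) (by positivity)] with x hx
  refine hx.trans (le_of_eq ?_)
  field_simp

end Summit.Parity.BatemanHorn.Theorems.UpperGradeRungs
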